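import Literature.Probability.Percolation.SlabRSWSnapDatum
import HarnessLib

/-!
# Newman–Tassion–Wu 2017, Lemma 3.16 — the local frame of a point against the coarse lattice

Topic: `Literature/Probability/Percolation`. Second file of the coarse-grained gluing datum
(`SlabRSWSnapDatum.lean`). NTW: "the domain `K_□` is regular enough to apply Theorem 3.6" — here is
the regularity, quantified. Around any planar point `p` of `R' = [0,14n]×[0,13n-1]` below the row
`13n - 42` we build a FRAME: a rectangle `B = [x₁,x₂]×[y₁,y₂] ⊆ R'` with
`(p + B_1) ∩ R' ⊆ B ⊆ p + B_12`, `p` at distance `≥ 8` from every side of `B` that is not a wall of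
`R'`, and two "lines" `X`, `Y` such that

* every tile `sqBox c 40` with `c` on the coarse lattice meets `B` in `∅`, `B`, `B ∩ {x ≤ X}` or
  `B ∩ {x ≥ X}` horizontally (and likewise vertically with `Y`) — `IsFrame.htx / hty`;
* `X ∈ {x₁ - 1, x₁, x₂} ∪ [x₁ + 4, x₂ - 4]` and `Y ∈ {y₁ - 1, y₁} ∪ [y₁ + 4, y₂ - 4]` — no free
  sliver of width `1..3` (`IsFrame.hX / hY`): the box is SHRUNK past a line that would sit at distance
  `≤ 3` inside a non-wall side, the offset `snapOff n` keeps lattice abscissae off `{1,2,3}` and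
  `{14n-3,…,14n-1}`, `0 ∈ 40ℤ` handles the bottom wall, and the top wall is out of reach.

Consequently a union `U` of tile traces on `B` is star-shaped about the hub
`ĉ = (max x₁ X, max y₁ Y)`: every cell of `U` lies in a rectangle inside `U` containing `ĉ`
(`exists_rect_of_mem_tileUnion`). The classification of the free part `B ∖ U` around `p` is in the
next file.

## Sources

* C. M. Newman, V. Tassion, W. Wu, *Critical percolation and the minimal spanning tree in slabs*,
  Comm. Pure Appl. Math. 70 (2017), arXiv:1512.09107: §3.5, proof of Lemma 3.16 ("`K_□` … regular
  enough"), Remark 2 after Theorem 3.7 [NewmanTassionWu2017].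
-/

noncomputable section

namespace Literature.Probability.Percolation

open MeasureTheory LatticeModels SimpleGraph

namespace NTW17

variable {k : ℕ}

/-! ## Unions of tiles -/

section Tiles

/-- The union of the tiles `sqBox c 40` centred at the points of `C`.
[cite: NewmanTassionWu2017, §3.5 (proof of Lemma 3.16, K_□ = ⋃ B̄_r(z))] -/
def tileUnion (C : Set (ℤ × ℤ)) : Set (ℤ × ℤ) := {z | ∃ c ∈ C, z ∈ sqBox c 40}

/-- Monotonicity of `tileUnion`. [cite: NewmanTassionWu2017, §3.5 (proof of Lemma 3.16)] -/
theorem tileUnion_mono {C C' : Set (ℤ × ℤ)} (h : C ⊆ C') : tileUnion C ⊆ tileUnion C' :=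
  fun _ ⟨c, hc, hz⟩ => ⟨c, h hc, hz⟩

/-- `tileUnion (C ∪ C') = tileUnion C ∪ tileUnion C'`. [cite: NewmanTassionWu2017, §3.5 (proof of Lemma 3.16)] -/
theorem tileUnion_union (C C' : Set (ℤ × ℤ)) : tileUnion (C ∪ C') = tileUnion C ∪ tileUnion C' := by
  ext z
  constructor
  · rintro ⟨c, hc | hc, hz⟩
    · exact Or.inl ⟨c, hc, hz⟩
    · exact Or.inr ⟨c, hc, hz⟩
  · rintro (⟨c, hc, hz⟩ | ⟨c, hc, hz⟩)
    · exact ⟨c, Or.inl hc, hz⟩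
    · exact ⟨c, Or.inr hc, hz⟩

variable (k)

/-- The tile centres of `N(Γ)`: the snapped cells of `Γ`. [cite: NewmanTassionWu2017, §3.5 (proof of Lemma 3.16)] -/
def snapCentres (n : ℕ) (Γ : List (slab 3 k)) : Set (ℤ × ℤ) := {c | ∃ g ∈ Γ, c = snap n (planar k g)}

/-- The tile centres of `τN(Γ)`: the mirrors of the snapped cells of `Γ`. [cite: NewmanTassionWu2017, §3.5 (proof of Lemma 3.16)] -/
def snapCentresR (n : ℕ) (Γ : List (slab 3 k)) : Set (ℤ × ℤ) :=
  {c | ∃ g ∈ Γ, c = planarReflect (14 * (n : ℤ)) (snap n (planar k g))}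

variable {k}

/-- `N(Γ)` is the tile union of the snapped cells. [cite: NewmanTassionWu2017, §3.5 (proof of Lemma 3.16)] -/
theorem snapNbhd_eq_tileUnion (n : ℕ) (Γ : List (slab 3 k)) :
    snapNbhd k n Γ = tileUnion (snapCentres k n Γ) := by
  ext z
  constructor
  · rintro ⟨g, hg, hz⟩
    exact ⟨_, ⟨g, hg, rfl⟩, hz⟩
  · rintro ⟨c, ⟨g, hg, rfl⟩, hz⟩
    exact ⟨g, hg, hz⟩

/-- `τN(Γ)` is the tile union of the mirrored snapped cells. [cite: NewmanTassionWu2017, §3.5 (proof of Lemma 3.16)] -/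
theorem snapNbhdR_eq_tileUnion (n : ℕ) (Γ : List (slab 3 k)) :
    snapNbhdR k n Γ = tileUnion (snapCentresR k n Γ) := by
  ext z
  rw [mem_snapNbhdR_iff]
  constructor
  · rintro ⟨g, hg, hz⟩
    refine ⟨_, ⟨g, hg, rfl⟩, ?_⟩
    rw [mem_sqBox_iff'] at hz ⊢
    simp only [planarReflect_apply] at hz ⊢
    omega
  · rintro ⟨c, ⟨g, hg, rfl⟩, hz⟩
    refine ⟨g, hg, ?_⟩
    rw [mem_sqBox_iff'] at hz ⊢
    simp only [planarReflect_apply] at hz ⊢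
    omega

/-- `M = N ∪ τN` is one tile union. [cite: NewmanTassionWu2017, §3.5 (proof of Lemma 3.16)] -/
theorem snapNbhd_union_eq_tileUnion (n : ℕ) (Γ : List (slab 3 k)) :
    snapNbhd k n Γ ∪ snapNbhdR k n Γ = tileUnion (snapCentres k n Γ ∪ snapCentresR k n Γ) := by
  rw [tileUnion_union, snapNbhd_eq_tileUnion, snapNbhdR_eq_tileUnion]

/-- The centres of `N(Γ)` are lattice points. [cite: NewmanTassionWu2017, §3.5 (proof of Lemma 3.16)] -/
theorem onLat_snapCentres {n : ℕ} {Γ : List (slab 3 k)} {c : ℤ × ℤ} (hc : c ∈ snapCentres k n Γ) :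
    OnLatX n c.1 ∧ OnLatY c.2 := by
  obtain ⟨g, -, rfl⟩ := hc
  exact ⟨onLatX_snap n _, onLatY_snap n _⟩

/-- The centres of `τN(Γ)` are lattice points. [cite: NewmanTassionWu2017, §3.5 (proof of Lemma 3.16)] -/
theorem onLat_snapCentresR {n : ℕ} {Γ : List (slab 3 k)} {c : ℤ × ℤ} (hc : c ∈ snapCentresR k n Γ) :
    OnLatX n c.1 ∧ OnLatY c.2 := by
  obtain ⟨g, -, rfl⟩ := hc
  simp only [planarReflect_apply]
  exact ⟨onLatX_reflect n (onLatX_snap n _), onLatY_snap n _⟩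

/-- The centres of `M` are lattice points. [cite: NewmanTassionWu2017, §3.5 (proof of Lemma 3.16)] -/
theorem onLat_snapCentres_union {n : ℕ} {Γ : List (slab 3 k)} {c : ℤ × ℤ}
    (hc : c ∈ snapCentres k n Γ ∪ snapCentresR k n Γ) : OnLatX n c.1 ∧ OnLatY c.2 := by
  rcases hc with hc | hc
  · exact onLat_snapCentres hc
  · exact onLat_snapCentresR hc

end Tiles

/-! ## The frame of a point -/

section Frame

/-- The lattice abscissa within `16` of `p.1`, if any (else a far-away dummy value `p.1 - 17`).
[cite: NewmanTassionWu2017, §3.5 (proof of Lemma 3.16, the grid 2rℤ²)] -/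
def latX (n : ℕ) (p : ℤ × ℤ) : ℤ := by
  classical
  exact if h : ∃ ℓ, OnLatX n ℓ ∧ p.1 - 16 ≤ ℓ ∧ ℓ ≤ p.1 + 16 then h.choose else p.1 - 17

/-- The lattice ordinate within `16` of `p.2`, if any (else `p.2 - 17`).
[cite: NewmanTassionWu2017, §3.5 (proof of Lemma 3.16, the grid 2rℤ²)] -/
def latY (p : ℤ × ℤ) : ℤ := by
  classical
  exact if h : ∃ ℓ, OnLatY ℓ ∧ p.2 - 16 ≤ ℓ ∧ ℓ ≤ p.2 + 16 then h.choose else p.2 - 17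

/-- Specification of `latX`. [cite: NewmanTassionWu2017, §3.5 (proof of Lemma 3.16)] -/
theorem latX_spec (n : ℕ) (p : ℤ × ℤ) :
    (OnLatX n (latX n p) ∧ p.1 - 16 ≤ latX n p ∧ latX n p ≤ p.1 + 16) ∨
    (latX n p = p.1 - 17 ∧ ∀ ℓ, OnLatX n ℓ → ¬(p.1 - 16 ≤ ℓ ∧ ℓ ≤ p.1 + 16)) := by
  unfold latX
  split_ifs with h
  · exact Or.inl h.choose_spec
  · right
    refine ⟨rfl, fun ℓ hℓ hb => h ⟨ℓ, hℓ, hb⟩⟩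

/-- Specification of `latY`. [cite: NewmanTassionWu2017, §3.5 (proof of Lemma 3.16)] -/
theorem latY_spec (p : ℤ × ℤ) :
    (OnLatY (latY p) ∧ p.2 - 16 ≤ latY p ∧ latY p ≤ p.2 + 16) ∨
    (latY p = p.2 - 17 ∧ ∀ ℓ, OnLatY ℓ → ¬(p.2 - 16 ≤ ℓ ∧ ℓ ≤ p.2 + 16)) := by
  unfold latY
  split_ifs with h
  · exact Or.inl h.choose_spec
  · right
    refine ⟨rfl, fun ℓ hℓ hb => h ⟨ℓ, hℓ, hb⟩⟩

/-- Any lattice abscissa within `16` of `p.1` is `latX`. [cite: NewmanTassionWu2017, §3.5 (proof of Lemma 3.16)] -/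
theorem eq_latX {n : ℕ} {p : ℤ × ℤ} {ℓ : ℤ} (hℓ : OnLatX n ℓ) (h1 : p.1 - 16 ≤ ℓ) (h2 : ℓ ≤ p.1 + 16) :
    ℓ = latX n p := by
  rcases latX_spec n p with ⟨hL, hL1, hL2⟩ | ⟨-, hno⟩
  · exact onLatX_unique n hℓ hL (by omega) (by omega)
  · exact absurd ⟨h1, h2⟩ (hno ℓ hℓ)

/-- Any lattice ordinate within `16` of `p.2` is `latY`. [cite: NewmanTassionWu2017, §3.5 (proof of Lemma 3.16)] -/
theorem eq_latY {p : ℤ × ℤ} {ℓ : ℤ} (hℓ : OnLatY ℓ) (h1 : p.2 - 16 ≤ ℓ) (h2 : ℓ ≤ p.2 + 16) : ℓ = latY p := by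
  rcases latY_spec p with ⟨hL, hL1, hL2⟩ | ⟨-, hno⟩
  · exact onLatY_unique hℓ hL (by omega) (by omega)
  · exact absurd ⟨h1, h2⟩ (hno ℓ hℓ)

/-- Left side of the frame: shrunk past `latX` if that line is within `3` inside `p.1 - 12` and the
side is not the wall `x = 0`. [cite: NewmanTassionWu2017, §3.5 (proof of Lemma 3.16)] -/
def fx₁ (n : ℕ) (p : ℤ × ℤ) : ℤ :=
  if 1 ≤ p.1 - 12 ∧ p.1 - 12 ≤ latX n p ∧ latX n p ≤ p.1 - 9 then latX n p + 1 else max 0 (p.1 - 12)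

/-- Right side of the frame. [cite: NewmanTassionWu2017, §3.5 (proof of Lemma 3.16)] -/
def fx₂ (n : ℕ) (p : ℤ × ℤ) : ℤ :=
  if p.1 + 12 ≤ 14 * (n : ℤ) - 1 ∧ p.1 + 9 ≤ latX n p ∧ latX n p ≤ p.1 + 12 then latX n p - 1
  else min (14 * (n : ℤ)) (p.1 + 12)

/-- Bottom side of the frame. [cite: NewmanTassionWu2017, §3.5 (proof of Lemma 3.16)] -/
def fy₁ (p : ℤ × ℤ) : ℤ :=
  if 1 ≤ p.2 - 12 ∧ p.2 - 12 ≤ latY p ∧ latY p ≤ p.2 - 9 then latY p + 1 else max 0 (p.2 - 12)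

/-- Top side of the frame (never a wall: `p` is assumed below the row `13n - 42`).
[cite: NewmanTassionWu2017, §3.5 (proof of Lemma 3.16)] -/
def fy₂ (p : ℤ × ℤ) : ℤ :=
  if p.2 + 9 ≤ latY p ∧ latY p ≤ p.2 + 12 then latY p - 1 else p.2 + 12

/-- The vertical line of the frame: `latX` if it meets `[x₁, x₂]`, else the virtual line `x₁ - 1`.
[cite: NewmanTassionWu2017, §3.5 (proof of Lemma 3.16)] -/
def fX (n : ℕ) (p : ℤ × ℤ) : ℤ :=
  if fx₁ n p ≤ latX n p ∧ latX n p ≤ fx₂ n p then latX n p else fx₁ n p - 1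

/-- The horizontal line of the frame. [cite: NewmanTassionWu2017, §3.5 (proof of Lemma 3.16)] -/
def fY (p : ℤ × ℤ) : ℤ :=
  if fy₁ p ≤ latY p ∧ latY p ≤ fy₂ p then latY p else fy₁ p - 1

/-- **What a frame provides.** A rectangle `[x₁,x₂]×[y₁,y₂] ⊆ R'` around `p` (within `12`, `p` at
depth `≥ 8` from non-wall sides, `(p + B_1) ∩ R'` inside) and two lines `X`, `Y` such that every
tile with a lattice centre meets `[x₁,x₂]` in `∅`, everything, `{x ≤ X}` or `{x ≥ X}` (the last two
only when `X` is a real line `≥ x₁`), the same vertically, and no line sits at distance `1..3`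
inside a side. [cite: NewmanTassionWu2017, §3.5 (proof of Lemma 3.16, "K_□ … regular enough")] -/
structure IsFrame (n : ℕ) (p : ℤ × ℤ) (x₁ x₂ y₁ y₂ X Y : ℤ) : Prop where
  hx₁ : 0 ≤ x₁
  hx₂ : x₂ ≤ 14 * n
  hy₁ : 0 ≤ y₁
  hy₂ : y₂ ≤ 13 * n - 1
  hpx₁ : x₁ ≤ p.1
  hpx₂ : p.1 ≤ x₂
  hpy₁ : y₁ ≤ p.2
  hpy₂ : p.2 ≤ y₂
  hbx₁ : p.1 - 12 ≤ x₁
  hbx₂ : x₂ ≤ p.1 + 12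
  hby₁ : p.2 - 12 ≤ y₁
  hby₂ : y₂ ≤ p.2 + 12
  hdx₁ : x₁ ≤ p.1 - 8 ∨ x₁ = 0
  hdx₂ : p.1 + 8 ≤ x₂ ∨ x₂ = 14 * n
  hdy₁ : y₁ ≤ p.2 - 8 ∨ y₁ = 0
  hdy₂ : p.2 + 8 ≤ y₂
  hX : X = x₁ - 1 ∨ X = x₁ ∨ X = x₂ ∨ (x₁ + 4 ≤ X ∧ X ≤ x₂ - 4)
  hY : Y = y₁ - 1 ∨ Y = y₁ ∨ (y₁ + 4 ≤ Y ∧ Y ≤ y₂ - 4)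
  hXle : X ≤ x₂
  hYle : Y ≤ y₂
  htx : ∀ a, OnLatX n a → (a + 40 < x₁ ∨ x₂ < a - 40) ∨ (a - 40 ≤ x₁ ∧ x₂ ≤ a + 40) ∨
    (a + 40 = X ∧ x₁ ≤ X) ∨ (a - 40 = X ∧ x₁ ≤ X)
  hty : ∀ b, OnLatY b → (b + 40 < y₁ ∨ y₂ < b - 40) ∨ (b - 40 ≤ y₁ ∧ y₂ ≤ b + 40) ∨
    (b + 40 = Y ∧ y₁ ≤ Y) ∨ (b - 40 = Y ∧ y₁ ≤ Y)

/-- **Every point of `R'` below the row `13n - 42` has a frame** (`n ≥ 1`).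
[cite: NewmanTassionWu2017, §3.5 (proof of Lemma 3.16, "K_□ … regular enough")] -/
theorem isFrame_frame {n : ℕ} {p : ℤ × ℤ} (hp1 : 0 ≤ p.1) (hp2 : p.1 ≤ 14 * n) (hp3 : 0 ≤ p.2)
    (hp4 : p.2 ≤ 13 * n - 42) :
    IsFrame n p (fx₁ n p) (fx₂ n p) (fy₁ p) (fy₂ p) (fX n p) (fY p) := by
  have hLX := latX_spec n p
  have hLY := latY_spec p
  -- unfold the six definitions into case hypotheses
  have ex₁ : (1 ≤ p.1 - 12 ∧ p.1 - 12 ≤ latX n p ∧ latX n p ≤ p.1 - 9 ∧ fx₁ n p = latX n p + 1) ∨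
      (¬(1 ≤ p.1 - 12 ∧ p.1 - 12 ≤ latX n p ∧ latX n p ≤ p.1 - 9) ∧ fx₁ n p = max 0 (p.1 - 12)) := by
    unfold fx₁; split_ifs with h
    · exact Or.inl ⟨h.1, h.2.1, h.2.2, rfl⟩
    · exact Or.inr ⟨h, rfl⟩
  have ex₂ : (p.1 + 12 ≤ 14 * (n : ℤ) - 1 ∧ p.1 + 9 ≤ latX n p ∧ latX n p ≤ p.1 + 12 ∧
        fx₂ n p = latX n p - 1) ∨
      (¬(p.1 + 12 ≤ 14 * (n : ℤ) - 1 ∧ p.1 + 9 ≤ latX n p ∧ latX n p ≤ p.1 + 12) ∧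
        fx₂ n p = min (14 * (n : ℤ)) (p.1 + 12)) := by
    unfold fx₂; split_ifs with h
    · exact Or.inl ⟨h.1, h.2.1, h.2.2, rfl⟩
    · exact Or.inr ⟨h, rfl⟩
  have ey₁ : (1 ≤ p.2 - 12 ∧ p.2 - 12 ≤ latY p ∧ latY p ≤ p.2 - 9 ∧ fy₁ p = latY p + 1) ∨
      (¬(1 ≤ p.2 - 12 ∧ p.2 - 12 ≤ latY p ∧ latY p ≤ p.2 - 9) ∧ fy₁ p = max 0 (p.2 - 12)) := by
    unfold fy₁; split_ifs with h
    · exact Or.inl ⟨h.1, h.2.1, h.2.2, rfl⟩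
    · exact Or.inr ⟨h, rfl⟩
  have ey₂ : (p.2 + 9 ≤ latY p ∧ latY p ≤ p.2 + 12 ∧ fy₂ p = latY p - 1) ∨
      (¬(p.2 + 9 ≤ latY p ∧ latY p ≤ p.2 + 12) ∧ fy₂ p = p.2 + 12) := by
    unfold fy₂; split_ifs with h
    · exact Or.inl ⟨h.1, h.2, rfl⟩
    · exact Or.inr ⟨h, rfl⟩
  have eX : (fx₁ n p ≤ latX n p ∧ latX n p ≤ fx₂ n p ∧ fX n p = latX n p) ∨
      (¬(fx₁ n p ≤ latX n p ∧ latX n p ≤ fx₂ n p) ∧ fX n p = fx₁ n p - 1) := by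
    unfold fX; split_ifs with h
    · exact Or.inl ⟨h.1, h.2, rfl⟩
    · exact Or.inr ⟨h, rfl⟩
  have eY : (fy₁ p ≤ latY p ∧ latY p ≤ fy₂ p ∧ fY p = latY p) ∨
      (¬(fy₁ p ≤ latY p ∧ latY p ≤ fy₂ p) ∧ fY p = fy₁ p - 1) := by
    unfold fY; split_ifs with h
    · exact Or.inl ⟨h.1, h.2, rfl⟩
    · exact Or.inr ⟨h, rfl⟩
  -- the offset facts at the walls
  have hw₁ : OnLatX n (latX n p) → ¬(1 ≤ latX n p ∧ latX n p ≤ 3) := fun h => not_onLatX_small n h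
  have hw₂ : OnLatX n (latX n p) → ¬(14 * n - 3 ≤ latX n p ∧ latX n p ≤ 14 * n - 1) :=
    fun h => not_onLatX_large n h
  have hw₃ : OnLatY (latY p) → ¬(1 ≤ latY p ∧ latY p ≤ 3) := fun h => not_onLatY_small h
  set x₁ := fx₁ n p
  set x₂ := fx₂ n p
  set y₁ := fy₁ p
  set y₂ := fy₂ p
  set X := fX n p
  set Y := fY p
  -- basic box facts, with `X`, `Y` eliminated
  have bx : 0 ≤ x₁ ∧ x₂ ≤ 14 * n ∧ x₁ ≤ p.1 ∧ p.1 ≤ x₂ ∧ p.1 - 12 ≤ x₁ ∧ x₂ ≤ p.1 + 12 ∧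
      (x₁ ≤ p.1 - 8 ∨ x₁ = 0) ∧ (p.1 + 8 ≤ x₂ ∨ x₂ = 14 * n) := by
    rcases hLX with ⟨-, hL1, hL2⟩ | ⟨hLe, -⟩
    · rcases ex₁ with ⟨a1, a2, a3, e1⟩ | ⟨a, e1⟩ <;> rcases ex₂ with ⟨b1, b2, b3, e2⟩ | ⟨b, e2⟩ <;>
        rw [e1, e2] <;> omega
    · rcases ex₁ with ⟨a1, a2, a3, e1⟩ | ⟨a, e1⟩ <;> rcases ex₂ with ⟨b1, b2, b3, e2⟩ | ⟨b, e2⟩ <;>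
        rw [e1, e2] <;> omega
  have bY : 0 ≤ y₁ ∧ y₂ ≤ 13 * n - 1 ∧ y₁ ≤ p.2 ∧ p.2 ≤ y₂ ∧ p.2 - 12 ≤ y₁ ∧ y₂ ≤ p.2 + 12 ∧
      (y₁ ≤ p.2 - 8 ∨ y₁ = 0) ∧ p.2 + 8 ≤ y₂ := by
    rcases hLY with ⟨-, hL1, hL2⟩ | ⟨hLe, -⟩
    · rcases ey₁ with ⟨a1, a2, a3, e1⟩ | ⟨a, e1⟩ <;> rcases ey₂ with ⟨b1, b2, e2⟩ | ⟨b, e2⟩ <;>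
        rw [e1, e2] <;> omega
    · rcases ey₁ with ⟨a1, a2, a3, e1⟩ | ⟨a, e1⟩ <;> rcases ey₂ with ⟨b1, b2, e2⟩ | ⟨b, e2⟩ <;>
        rw [e1, e2] <;> omega
  obtain ⟨bx1, bx2, bx3, bx4, bx5, bx6, bx7, bx8⟩ := bx
  obtain ⟨by1, by2, by3, by4, by5, by6, by7, by8⟩ := bY
  -- the line facts
  have lX : (X = x₁ - 1 ∨ X = x₁ ∨ X = x₂ ∨ (x₁ + 4 ≤ X ∧ X ≤ x₂ - 4)) ∧ X ≤ x₂ ∧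
      (x₁ ≤ latX n p → latX n p ≤ x₂ → X = latX n p) ∧ (X ≠ latX n p → X = x₁ - 1) := by
    rcases eX with ⟨c1, c2, e⟩ | ⟨c, e⟩
    · rw [e]
      refine ⟨?_, c2, fun _ _ => rfl, fun h => absurd rfl h⟩
      rcases hLX with ⟨hL, hL1, hL2⟩ | ⟨hLe, -⟩
      · have h1 := hw₁ hL
        have h2 := hw₂ hL
        rcases ex₁ with ⟨a1, a2, a3, e1⟩ | ⟨a, e1⟩ <;> rcases ex₂ with ⟨b1, b2, b3, e2⟩ | ⟨b, e2⟩
        · exfalso; rw [e1] at c1; omega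
        · exfalso; rw [e1] at c1; omega
        · exfalso; rw [e2] at c2; omega
        · have c1' := c1; have c2' := c2
          rw [e1] at c1' ⊢; rw [e2] at c2' ⊢
          omega
      · exfalso; omega
    · rw [e]
      exact ⟨Or.inl rfl, by omega, fun h1 h2 => absurd ⟨h1, h2⟩ c, fun _ => rfl⟩
  have lY : (Y = y₁ - 1 ∨ Y = y₁ ∨ (y₁ + 4 ≤ Y ∧ Y ≤ y₂ - 4)) ∧ Y ≤ y₂ ∧
      (y₁ ≤ latY p → latY p ≤ y₂ → Y = latY p) ∧ (Y ≠ latY p → Y = y₁ - 1) := by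
    rcases eY with ⟨c1, c2, e⟩ | ⟨c, e⟩
    · rw [e]
      refine ⟨?_, c2, fun _ _ => rfl, fun h => absurd rfl h⟩
      rcases hLY with ⟨hL, hL1, hL2⟩ | ⟨hLe, -⟩
      · have h3 := hw₃ hL
        rcases ey₁ with ⟨a1, a2, a3, e1⟩ | ⟨a, e1⟩ <;> rcases ey₂ with ⟨b1, b2, e2⟩ | ⟨b, e2⟩
        · exfalso; rw [e1] at c1; omega
        · exfalso; rw [e1] at c1; omega
        · exfalso; rw [e2] at c2; omega
        · have c1' := c1; have c2' := c2
          rw [e1] at c1' ⊢; rw [e2] at c2' ⊢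
          omega
      · exfalso; omega
    · rw [e]
      exact ⟨Or.inl rfl, by omega, fun h1 h2 => absurd ⟨h1, h2⟩ c, fun _ => rfl⟩
  obtain ⟨lX1, lX2, lX3, lX4⟩ := lX
  obtain ⟨lY1, lY2, lY3, lY4⟩ := lY
  refine ⟨bx1, bx2, by1, by2, bx3, bx4, by3, by4, bx5, bx6, by5, by6, bx7, bx8, by7, by8, lX1, lY1,
    lX2, lY2, fun a ha => ?_, fun b hb => ?_⟩
  · -- tile traces in `x`
    by_cases h1 : x₁ ≤ a + 40 ∧ a + 40 ≤ x₂
    · have hlat := eq_latX (p := p) (onLatX_add n ha 1) (by omega) (by omega)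
      have hXeq := lX3 (by omega) (by omega)
      right; right; left
      constructor <;> omega
    by_cases h2 : x₁ ≤ a - 40 ∧ a - 40 ≤ x₂
    · have hlat := eq_latX (p := p) (onLatX_add n ha (-1)) (by omega) (by omega)
      have hXeq := lX3 (by omega) (by omega)
      right; right; right
      constructor <;> omega
    by_cases h3 : a - 40 ≤ x₁ ∧ x₂ ≤ a + 40
    · exact Or.inr (Or.inl h3)
    · left; omega
  · -- tile traces in `y`
    by_cases h1 : y₁ ≤ b + 40 ∧ b + 40 ≤ y₂
    · have hlat := eq_latY (p := p) (onLatY_add hb 1) (by omega) (by omega)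
      have hYeq := lY3 (by omega) (by omega)
      right; right; left
      constructor <;> omega
    by_cases h2 : y₁ ≤ b - 40 ∧ b - 40 ≤ y₂
    · have hlat := eq_latY (p := p) (onLatY_add hb (-1)) (by omega) (by omega)
      have hYeq := lY3 (by omega) (by omega)
      right; right; right
      constructor <;> omega
    by_cases h3 : b - 40 ≤ y₁ ∧ y₂ ≤ b + 40
    · exact Or.inr (Or.inl h3)
    · left; omega

end Frame

/-! ## Traces of tiles on a frame and the hub -/

section Traces

variable {n : ℕ} {p : ℤ × ℤ} {x₁ x₂ y₁ y₂ X Y : ℤ}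

/-- The HUB of a frame: `(max x₁ X, max y₁ Y)` (the line crossing, clamped into the box).
[cite: NewmanTassionWu2017, §3.5 (proof of Lemma 3.16)] -/
def hub (x₁ y₁ X Y : ℤ) : ℤ × ℤ := (max x₁ X, max y₁ Y)

/-- **The trace of a tile on a frame is a rectangle containing the hub**: for a lattice centre `c`
and `w ∈ sqBox c 40 ∩ B`, there is a rectangle inside `sqBox c 40 ∩ B` containing `w` and the hub.
[cite: NewmanTassionWu2017, §3.5 (proof of Lemma 3.16, "K_□ … regular enough")] -/
theorem exists_rect_of_mem_tile (hF : IsFrame n p x₁ x₂ y₁ y₂ X Y) {c : ℤ × ℤ} (hc1 : OnLatX n c.1)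
    (hc2 : OnLatY c.2) {w : ℤ × ℤ} (hw : w ∈ sqBox c 40) (hwB : w ∈ boxR x₁ x₂ y₁ y₂) :
    ∃ a b c' d : ℤ, w ∈ boxR a b c' d ∧ hub x₁ y₁ X Y ∈ boxR a b c' d ∧
      boxR a b c' d ⊆ sqBox c 40 ∩ boxR x₁ x₂ y₁ y₂ := by
  rw [mem_sqBox_iff'] at hw
  rw [mem_boxR_iff] at hwB
  push_cast at hw
  obtain ⟨fx₁, fx₂, fy₁, fy₂, fpx₁, fpx₂, fpy₁, fpy₂, fbx₁, fbx₂, fby₁, fby₂, -, -, -, -, hX, hY, hXle, hYle,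
    htx, hty⟩ := hF
  -- the `x`-trace: an interval `[a, b]` with `w.1, hub.1 ∈ [a,b] ⊆ [c.1-40, c.1+40] ∩ [x₁, x₂]`
  have hxI : ∃ a b : ℤ, a ≤ w.1 ∧ w.1 ≤ b ∧ a ≤ max x₁ X ∧ max x₁ X ≤ b ∧ c.1 - 40 ≤ a ∧ b ≤ c.1 + 40 ∧
      x₁ ≤ a ∧ b ≤ x₂ := by
    rcases htx c.1 hc1 with h | h | ⟨h, hr⟩ | ⟨h, hr⟩
    · exfalso; omega
    · exact ⟨x₁, x₂, by omega, by omega, by omega, by omega, by omega, by omega, le_rfl, le_rfl⟩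
    · exact ⟨x₁, X, by omega, by omega, by omega, by omega, by omega, by omega, le_rfl, by omega⟩
    · exact ⟨X, x₂, by omega, by omega, by omega, by omega, by omega, by omega, hr, le_rfl⟩
  have hyI : ∃ a b : ℤ, a ≤ w.2 ∧ w.2 ≤ b ∧ a ≤ max y₁ Y ∧ max y₁ Y ≤ b ∧ c.2 - 40 ≤ a ∧ b ≤ c.2 + 40 ∧
      y₁ ≤ a ∧ b ≤ y₂ := by
    rcases hty c.2 hc2 with h | h | ⟨h, hr⟩ | ⟨h, hr⟩
    · exfalso; omega
    · exact ⟨y₁, y₂, by omega, by omega, by omega, by omega, by omega, by omega, le_rfl, le_rfl⟩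
    · exact ⟨y₁, Y, by omega, by omega, by omega, by omega, by omega, by omega, le_rfl, by omega⟩
    · exact ⟨Y, y₂, by omega, by omega, by omega, by omega, by omega, by omega, hr, le_rfl⟩
  obtain ⟨a, b, h1, h2, h3, h4, h5, h6, h7, h8⟩ := hxI
  obtain ⟨a', b', h1', h2', h3', h4', h5', h6', h7', h8'⟩ := hyI
  refine ⟨a, b, a', b', ?_, ?_, fun z hz => ?_⟩
  · rw [mem_boxR_iff]; exact ⟨h1, h2, h1', h2'⟩
  · rw [hub, mem_boxR_iff]; exact ⟨h3, h4, h3', h4'⟩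
  · rw [mem_boxR_iff] at hz
    refine ⟨?_, ?_⟩
    · rw [mem_sqBox_iff']; push_cast; omega
    · rw [mem_boxR_iff]; omega

/-- **Star property of a tile union on a frame**: every cell of `tileUnion C ∩ B` (lattice centres)
lies in a rectangle inside `tileUnion C ∩ B` that contains the hub.
[cite: NewmanTassionWu2017, §3.5 (proof of Lemma 3.16, "K_□ … regular enough")] -/
theorem exists_rect_of_mem_tileUnion (hF : IsFrame n p x₁ x₂ y₁ y₂ X Y) {C : Set (ℤ × ℤ)}
    (hC : ∀ c ∈ C, OnLatX n c.1 ∧ OnLatY c.2) {w : ℤ × ℤ} (hw : w ∈ tileUnion C)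
    (hwB : w ∈ boxR x₁ x₂ y₁ y₂) :
    ∃ a b c' d : ℤ, w ∈ boxR a b c' d ∧ hub x₁ y₁ X Y ∈ boxR a b c' d ∧
      boxR a b c' d ⊆ tileUnion C ∩ boxR x₁ x₂ y₁ y₂ := by
  obtain ⟨c, hc, hwc⟩ := hw
  obtain ⟨a, b, c', d, h1, h2, h3⟩ := exists_rect_of_mem_tile hF (hC c hc).1 (hC c hc).2 hwc hwB
  exact ⟨a, b, c', d, h1, h2, fun z hz => ⟨⟨c, hc, (h3 hz).1⟩, (h3 hz).2⟩⟩

/-- In particular the hub lies in `tileUnion C` as soon as `tileUnion C` meets `B`.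
[cite: NewmanTassionWu2017, §3.5 (proof of Lemma 3.16)] -/
theorem hub_mem_tileUnion (hF : IsFrame n p x₁ x₂ y₁ y₂ X Y) {C : Set (ℤ × ℤ)}
    (hC : ∀ c ∈ C, OnLatX n c.1 ∧ OnLatY c.2) {w : ℤ × ℤ} (hw : w ∈ tileUnion C)
    (hwB : w ∈ boxR x₁ x₂ y₁ y₂) :
    hub x₁ y₁ X Y ∈ tileUnion C ∧ hub x₁ y₁ X Y ∈ boxR x₁ x₂ y₁ y₂ := by
  obtain ⟨a, b, c', d, -, h2, h3⟩ := exists_rect_of_mem_tileUnion hF hC hw hwB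
  exact h3 h2

/-- **The trace of a tile on a frame, as constraints**: for a lattice centre `c` and a cell `w` of
its tile in `B`, there are flags `(ex, ey) ∈ {0: none, 1: ≤, 2: ≥}²` such that the tile meets `B`
exactly in the cells satisfying the constraints `x ≤ X` / `x ≥ X` / none and `y ≤ Y` / `y ≥ Y` / none;
a `≤`/`≥` flag only occurs for a real line (`x₁ ≤ X`, resp. `y₁ ≤ Y`).
[cite: NewmanTassionWu2017, §3.5 (proof of Lemma 3.16, "K_□ … regular enough")] -/
theorem tile_trace (hF : IsFrame n p x₁ x₂ y₁ y₂ X Y) {c : ℤ × ℤ} (hc1 : OnLatX n c.1) (hc2 : OnLatY c.2)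
    {w : ℤ × ℤ} (hw : w ∈ sqBox c 40) (hwB : w ∈ boxR x₁ x₂ y₁ y₂) :
    ∃ ex ey : Fin 3, (ex ≠ 0 → x₁ ≤ X) ∧ (ey ≠ 0 → y₁ ≤ Y) ∧
      ∀ z : ℤ × ℤ, z ∈ boxR x₁ x₂ y₁ y₂ →
        (z ∈ sqBox c 40 ↔ ((ex = 1 → z.1 ≤ X) ∧ (ex = 2 → X ≤ z.1)) ∧ ((ey = 1 → z.2 ≤ Y) ∧ (ey = 2 → Y ≤ z.2))) := by
  rw [mem_sqBox_iff'] at hw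
  rw [mem_boxR_iff] at hwB
  push_cast at hw
  obtain ⟨fx₁, fx₂, fy₁, fy₂, fpx₁, fpx₂, fpy₁, fpy₂, fbx₁, fbx₂, fby₁, fby₂, -, -, -, -, hX, hY, hXle, hYle,
    htx, hty⟩ := hF
  -- `x`
  have hx : ∃ ex : Fin 3, (ex ≠ 0 → x₁ ≤ X) ∧ ∀ t : ℤ, x₁ ≤ t → t ≤ x₂ →
      ((c.1 - 40 ≤ t ∧ t ≤ c.1 + 40) ↔ ((ex = 1 → t ≤ X) ∧ (ex = 2 → X ≤ t))) := by
    rcases htx c.1 hc1 with h | h | ⟨h, hr⟩ | ⟨h, hr⟩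
    · exfalso; omega
    · exact ⟨0, by simp, fun t h1 h2 => by simp; omega⟩
    · exact ⟨1, fun _ => hr, fun t h1 h2 => by simp; omega⟩
    · exact ⟨2, fun _ => hr, fun t h1 h2 => by simp; omega⟩
  have hy : ∃ ey : Fin 3, (ey ≠ 0 → y₁ ≤ Y) ∧ ∀ t : ℤ, y₁ ≤ t → t ≤ y₂ →
      ((c.2 - 40 ≤ t ∧ t ≤ c.2 + 40) ↔ ((ey = 1 → t ≤ Y) ∧ (ey = 2 → Y ≤ t))) := by
    rcases hty c.2 hc2 with h | h | ⟨h, hr⟩ | ⟨h, hr⟩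
    · exfalso; omega
    · exact ⟨0, by simp, fun t h1 h2 => by simp; omega⟩
    · exact ⟨1, fun _ => hr, fun t h1 h2 => by simp; omega⟩
    · exact ⟨2, fun _ => hr, fun t h1 h2 => by simp; omega⟩
  obtain ⟨ex, hex, hx⟩ := hx
  obtain ⟨ey, hey, hy⟩ := hy
  refine ⟨ex, ey, hex, hey, fun z hz => ?_⟩
  rw [mem_boxR_iff] at hz
  rw [mem_sqBox_iff', ← hx z.1 hz.1 hz.2.1, ← hy z.2 hz.2.2.1 hz.2.2.2]
  push_cast
  constructor
  · rintro ⟨h1, h2, h3, h4⟩; exact ⟨⟨h1, h2⟩, h3, h4⟩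
  · rintro ⟨⟨h1, h2⟩, h3, h4⟩; exact ⟨h1, h2, h3, h4⟩

end Traces

/-! ## Non-degeneracy: the lines of a frame are interior for the actual tile families -/

section NonDegenerate

variable {k : ℕ}

/-- **An admissible tile centre**: a lattice point with `-20 ≤ c.1 ≤ 14n + 20` and `0 ≤ c.2` (the
snapped cells of a path in `[0,7n] × [0, ·]` and their mirrors are such).
[cite: NewmanTassionWu2017, §3.5 (proof of Lemma 3.16, the grid 2rℤ²)] -/
def LatCentre (n : ℕ) (c : ℤ × ℤ) : Prop :=
  OnLatX n c.1 ∧ OnLatY c.2 ∧ -20 ≤ c.1 ∧ c.1 ≤ 14 * n + 20 ∧ 0 ≤ c.2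

/-- The snapped ordinate of a point with `p.2 ≥ 0` is `≥ 0`. [cite: NewmanTassionWu2017, §3.5 (proof of Lemma 3.16)] -/
theorem snap_snd_nonneg (n : ℕ) {p : ℤ × ℤ} (hp : 0 ≤ p.2) : 0 ≤ (snap n p).2 := by
  rw [snap_snd]; omega

/-- The centres of `N(Γ)` are admissible when `Γ ⊆ [0,7n] × [0,·]`.
[cite: NewmanTassionWu2017, §3.5 (proof of Lemma 3.16)] -/
theorem latCentre_snapCentres {n : ℕ} {Γ : List (slab 3 k)}
    (hΓ : ∀ g ∈ Γ, 0 ≤ (planar k g).1 ∧ (planar k g).1 ≤ 7 * n ∧ 0 ≤ (planar k g).2) {c : ℤ × ℤ}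
    (hc : c ∈ snapCentres k n Γ) : LatCentre n c := by
  obtain ⟨g, hg, rfl⟩ := hc
  obtain ⟨h1, h2, h3⟩ := hΓ g hg
  have hb := snap_bounds n (planar k g)
  exact ⟨onLatX_snap n _, onLatY_snap n _, by omega, by omega, snap_snd_nonneg n h3⟩

/-- The centres of `τN(Γ)` are admissible when `Γ ⊆ [0,7n] × [0,·]`.
[cite: NewmanTassionWu2017, §3.5 (proof of Lemma 3.16)] -/
theorem latCentre_snapCentresR {n : ℕ} {Γ : List (slab 3 k)}
    (hΓ : ∀ g ∈ Γ, 0 ≤ (planar k g).1 ∧ (planar k g).1 ≤ 7 * n ∧ 0 ≤ (planar k g).2) {c : ℤ × ℤ}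
    (hc : c ∈ snapCentresR k n Γ) : LatCentre n c := by
  obtain ⟨g, hg, rfl⟩ := hc
  obtain ⟨h1, h2, h3⟩ := hΓ g hg
  have hb := snap_bounds n (planar k g)
  have h0 := snap_snd_nonneg n h3
  simp only [planarReflect_apply]
  exact ⟨onLatX_reflect n (onLatX_snap n _), onLatY_snap n _, by omega, by omega, h0⟩

/-- The centres of `M = N ∪ τN` are admissible. [cite: NewmanTassionWu2017, §3.5 (proof of Lemma 3.16)] -/
theorem latCentre_union {n : ℕ} {Γ : List (slab 3 k)}
    (hΓ : ∀ g ∈ Γ, 0 ≤ (planar k g).1 ∧ (planar k g).1 ≤ 7 * n ∧ 0 ≤ (planar k g).2) {c : ℤ × ℤ}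
    (hc : c ∈ snapCentres k n Γ ∪ snapCentresR k n Γ) : LatCentre n c := by
  rcases hc with hc | hc
  · exact latCentre_snapCentres hΓ hc
  · exact latCentre_snapCentresR hΓ hc

/-- **The wall facts of a frame**: a real line ON a side of the box can only be a wall of `R'`
(`x = 0`, `x = 14n`, `y = 0`). [cite: NewmanTassionWu2017, §3.5 (proof of Lemma 3.16)] -/
structure IsFrameND (n : ℕ) (x₁ x₂ y₁ X Y : ℤ) : Prop where
  hXw : X = x₁ → x₁ = 0
  hXe : X = x₂ → x₂ = 14 * n
  hYw : Y = y₁ → y₁ = 0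

/-- The frame of a point satisfies the wall facts. [cite: NewmanTassionWu2017, §3.5 (proof of Lemma 3.16)] -/
theorem isFrameND_frame {n : ℕ} {p : ℤ × ℤ} (hp1 : 0 ≤ p.1) (hp2 : p.1 ≤ 14 * n) (hp3 : 0 ≤ p.2)
    (hp4 : p.2 ≤ 13 * n - 42) : IsFrameND n (fx₁ n p) (fx₂ n p) (fy₁ p) (fX n p) (fY p) := by
  have hF := isFrame_frame (n := n) hp1 hp2 hp3 hp4
  have hx₁₂ : fx₁ n p ≤ fx₂ n p := le_trans hF.hpx₁ hF.hpx₂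
  have hy₁₂ : fy₁ p ≤ fy₂ p := le_trans hF.hpy₁ hF.hpy₂
  refine ⟨fun h => ?_, fun h => ?_, fun h => ?_⟩
  · -- `X = x₁`: the line is real, `latX = x₁`, and the left side was not shrunk
    have hreal : fx₁ n p ≤ latX n p ∧ latX n p ≤ fx₂ n p ∧ fX n p = latX n p := by
      unfold fX at h ⊢; split_ifs with hc
      · exact ⟨hc.1, hc.2, rfl⟩
      · exfalso; omega
    have hL : latX n p = fx₁ n p := by rw [← hreal.2.2]; exact h
    unfold fx₁ at hL ⊢; split_ifs with hc
    · exfalso; omega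
    · push Not at hc; omega
  · have hreal : fx₁ n p ≤ latX n p ∧ latX n p ≤ fx₂ n p ∧ fX n p = latX n p := by
      unfold fX at h ⊢; split_ifs with hc
      · exact ⟨hc.1, hc.2, rfl⟩
      · exfalso; omega
    have hL : latX n p = fx₂ n p := by rw [← hreal.2.2]; exact h
    unfold fx₂ at hL ⊢; split_ifs with hc
    · exfalso; omega
    · push Not at hc; omega
  · have hreal : fy₁ p ≤ latY p ∧ latY p ≤ fy₂ p ∧ fY p = latY p := by
      unfold fY at h ⊢; split_ifs with hc
      · exact ⟨hc.1, hc.2, rfl⟩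
      · exfalso; omega
    have hL : latY p = fy₁ p := by rw [← hreal.2.2]; exact h
    unfold fy₁ at hL ⊢; split_ifs with hc
    · exfalso; omega
    · push Not at hc; omega

variable {n : ℕ} {p : ℤ × ℤ} {x₁ x₂ y₁ y₂ X Y : ℤ}

/-- **Horizontal traces of admissible tiles are non-degenerate**: disjoint, everything, or a proper
side of an INTERIOR line (`x₁ + 4 ≤ X ≤ x₂ - 4`). [cite: NewmanTassionWu2017, §3.5 (proof of Lemma 3.16, "K_□ … regular enough")] -/
theorem IsFrame.htx_nd (hF : IsFrame n p x₁ x₂ y₁ y₂ X Y) (hW : IsFrameND n x₁ x₂ y₁ X Y) {a : ℤ}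
    (ha : OnLatX n a) (ha1 : -20 ≤ a) (ha2 : a ≤ 14 * n + 20) :
    (a + 40 < x₁ ∨ x₂ < a - 40) ∨ (a - 40 ≤ x₁ ∧ x₂ ≤ a + 40) ∨
      (a + 40 = X ∧ x₁ + 4 ≤ X ∧ X + 4 ≤ x₂) ∨ (a - 40 = X ∧ x₁ + 4 ≤ X ∧ X + 4 ≤ x₂) := by
  have hX := hF.hX; have hbx₁ := hF.hbx₁; have hbx₂ := hF.hbx₂; have hpx₁ := hF.hpx₁; have hpx₂ := hF.hpx₂
  have hXw := hW.hXw; have hXe := hW.hXe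
  by_cases hcont : a - 40 ≤ x₁ ∧ x₂ ≤ a + 40
  · exact Or.inr (Or.inl hcont)
  rcases hF.htx a ha with h | h | ⟨h, hr⟩ | ⟨h, hr⟩
  · exact Or.inl h
  · exact absurd h hcont
  · right; right; left
    refine ⟨h, ?_, ?_⟩
    · rcases hX with hX | hX | hX | hX
      · omega
      · have := hXw hX; omega
      · omega
      · omega
    · omega
  · right; right; right
    refine ⟨h, ?_, ?_⟩
    · omega
    · rcases hX with hX | hX | hX | hX
      · omega
      · omega
      · have := hXe hX; omega
      · omega

/-- **Vertical traces of admissible tiles are non-degenerate.** [cite: NewmanTassionWu2017, §3.5 (proof of Lemma 3.16, "K_□ … regular enough")] -/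
theorem IsFrame.hty_nd (hF : IsFrame n p x₁ x₂ y₁ y₂ X Y) (hW : IsFrameND n x₁ x₂ y₁ X Y) {b : ℤ}
    (hb : OnLatY b) (hb0 : 0 ≤ b) :
    (b + 40 < y₁ ∨ y₂ < b - 40) ∨ (b - 40 ≤ y₁ ∧ y₂ ≤ b + 40) ∨
      (b + 40 = Y ∧ y₁ + 4 ≤ Y ∧ Y + 4 ≤ y₂) ∨ (b - 40 = Y ∧ y₁ + 4 ≤ Y ∧ Y + 4 ≤ y₂) := by
  have hY := hF.hY; have hby₁ := hF.hby₁; have hby₂ := hF.hby₂; have hpy₁ := hF.hpy₁; have hpy₂ := hF.hpy₂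
  have hYw := hW.hYw
  by_cases hcont : b - 40 ≤ y₁ ∧ y₂ ≤ b + 40
  · exact Or.inr (Or.inl hcont)
  rcases hF.hty b hb with h | h | ⟨h, hr⟩ | ⟨h, hr⟩
  · exact Or.inl h
  · exact absurd h hcont
  · right; right; left
    refine ⟨h, ?_, ?_⟩
    · rcases hY with hY | hY | hY
      · omega
      · have := hYw hY; omega
      · omega
    · omega
  · right; right; right
    refine ⟨h, ?_, ?_⟩
    · omega
    · rcases hY with hY | hY | hY
      · omega
      · omega
      · omega

end NonDegenerate

end NTW17

end Literature.Probability.Percolation
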